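import Summits.CriticalPhenomena.CardyFormulaZ2.Theorems.CardyAnchoredRigiditySubseqCardyKernelDuality
import Summits.CriticalPhenomena.CardyFormulaZ2.Theorems.CardyAnchoredRigiditySubseqCardyBoxLimits
import Summits.CriticalPhenomena.CardyFormulaZ2.Theorems.CardySelfDualSegmentSegmentClosedStubBoxCrossRatio
import Literature.Probability.RandomPlanarGeometry.RectangleModulusAspectRatio

/-!
# Sequential crossing kernels, III: the KERNEL FACTS — strict monotonicity and continuity on
# `(0,1)`, boundary values `f(0⁺) = 0`, `f(1⁻) = 1`
# (crux `SubseqCardy`, stmt-CriticalPhenomena-5768, line `registered`, lead c5: kernel facts, part 3)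

Route `CardyAnchoredRigidity` (decl shared with `CardyLocalRigidity`), sub-problem `CardyFormulaZ2`.
A SEQUENTIAL CROSSING KERNEL is (`u → 0⁺`, `f : ℝ → ℝ`) with `bondDomainCrossingProb R (u n) →
f (crossRatio x)` for every conformal rectangle `R` and every uniformizing datum `(φ, x)` — the
hypothesis HYPSEQ of the identification items stmt-8271 `SubseqRigidity` / stmt-4680 `CardyRigiditySeq`
/ stmt-8850 `SubseqCardyRigidity`, and of this line's stub S3 given S2. This file proves, for every
sequential crossing kernel, UNCONDITIONALLY:

* `Kernel.lr_eq` — on the boxes `(0,w) × (0,1)` crossed left-to-right the joint limit of `(u, f)` takes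
  the value `f (η w)`, `η` the strictly decreasing rectangle modulus of Bollobás–Riordan Ch. 7 (tree:
  `rectangle_crossRatio_eq_of_aspectRatio_holds`): the bottom-to-top marking `rectQuad 0 w 0 1` has
  modulus `1 - η w` (`stub_boxCrossRatio`), box self-duality `g L + g (rectQuad 0 w 0 1) = 1`
  (`JointLimit.lr_add_bt_eq_one`) and Cardy's functional equation (`Kernel.add_one_sub`, part 1);
* `Kernel.strictMonoOn` — **`f` is strictly increasing on `(0,1)`** (box values strictly decreasing in
  the width, `JointLimit.lr_strictAnti`, part 2);
* `Kernel.continuousOn` — **`f` is continuous on `(0,1)`** (box values continuous in the width,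
  `JointLimit.lr_continuous`, squeezed by monotonicity);
* `Kernel.tendsto_zero`, `Kernel.tendsto_one` — **`f(0⁺) = 0`, `f(1⁻) = 1`** (exponential decay of long
  left-to-right crossings, `JointLimit.lr_eventually_le`, and the functional equation);
* registered-style summary `seqKernelFacts` (the exact sequential twin of the landed full-filter
  `stub_kernelFacts` of crux `CardyRigidity`: `ContinuousOn f (Ioo 0 1) ∧ Tendsto f (𝓝[>] 0) (𝓝 0) ∧
  Tendsto f (𝓝[<] 1) (𝓝 1)`) and `seqKernel_strictMonoOn`.

So the martingale identification route (`stub_kernelAffineCardy`: continuity ⇒ `f = A·I_{2/3} + B`;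
boundary values ⇒ `A = 1`, `B = 0`) has its kernel input along SEQUENCES of meshes as well.

References: B. Bollobás, O. Riordan, *Percolation* (2006), Ch. 3 and Ch. 7 §7.1; J. Cardy, J. Phys.
A 25 (1992) L201; G. Grimmett, *Percolation* (1999) §11.7.
-/

noncomputable section

namespace Summit.CriticalPhenomena.CardyFormulaZ2.Cruxes.SubseqCardy.Birth

open Set Filter Topology Metric
open Literature.Probability.RandomPlanarGeometry
open Literature.Probability.Percolation (bondDomainCrossingProb rectQuad rectQuad_carrier)
open Summit.CriticalPhenomena.CardyFormulaZ2.Cruxes.SegmentClosed.Sketch (stub_boxCrossRatio)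

namespace Kernel

variable {u : ℕ → ℝ} {f : ℝ → ℝ}

/-! ### The modulus of the boxes and the left-to-right values of a kernel -/

/-- **The left-to-right box values of a sequential crossing kernel**: if `η` satisfies the
Bollobás–Riordan rectangle-modulus law (the `∀`-clause of `rectangle_crossRatio_eq_of_aspectRatio`)
then for every box `L_w = ((0,w) × (0,1); left, ·, right, ·)` the joint limit `g` of the kernel
`(u, f)` has `g L_w = f (η w)`, provided `η w ∈ (0,1)`. [cite: BollobasRiordan2006, Ch. 7 §7.1 p. 184] -/
theorem lr_eq (hu : Tendsto u atTop (𝓝[>] (0 : ℝ)))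
    (hf : ∀ (R : ConformalRectangle) (φ : ConformalEquiv UpperHalfPlane.upperHalfPlaneSet R.carrier)
      (x : Fin 4 → ℝ), R.IsUniformizing φ x →
      Tendsto (fun n => bondDomainCrossingProb R (u n)) atTop (𝓝 (f (crossRatio x))))
    {g : ConformalRectangle → ℝ}
    (hg : ∀ R : ConformalRectangle, Tendsto (fun n => bondDomainCrossingProb R (u n)) atTop (𝓝 (g R)))
    {η : ℝ → ℝ}
    (hη : ∀ (R : ConformalRectangle) (w h : ℝ), 0 < w → 0 < h →
      R.carrier = (Ioo (0:ℝ) w ×ℂ Ioo (0:ℝ) h) →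
      (R.pt 0 = (h:ℂ) * Complex.I ∧ R.pt 1 = 0 ∧ R.pt 2 = (w:ℂ) ∧ R.pt 3 = (w:ℂ) + (h:ℂ) * Complex.I) →
      ∀ (φ : ConformalEquiv UpperHalfPlane.upperHalfPlaneSet R.carrier) (x : Fin 4 → ℝ),
        R.IsUniformizing φ x → crossRatio x = η (w / h))
    {w : ℝ} (hw : 0 < w) (hηw : η w ∈ Ioo (0:ℝ) 1)
    (L : ConformalRectangle) (hLc : L.carrier = (Ioo (0:ℝ) w ×ℂ Ioo (0:ℝ) 1))
    (hL0 : L.arc 0 = {z : ℂ | z.re = 0 ∧ z.im ∈ Icc (0:ℝ) 1})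
    (hL2 : L.arc 2 = {z : ℂ | z.re = w ∧ z.im ∈ Icc (0:ℝ) 1}) : g L = f (η w) := by
  -- the bottom-to-top box has modulus `1 - η w`, hence value `f (1 - η w)`
  obtain ⟨φ, x, hx⟩ := MarkedDomain.exists_isUniformizing_holds (rectQuad 0 w 0 1 hw one_pos)
  have hcr : crossRatio x = 1 - η w := by
    have := stub_boxCrossRatio η hη hw one_pos φ x hx
    rwa [div_one] at this
  have hbt : g (rectQuad 0 w 0 1 hw one_pos) = f (1 - η w) := by
    rw [← hcr]; exact tendsto_nhds_unique (hg _) (hf _ φ x hx)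
  -- box self-duality and Cardy's functional equation
  have hdual := JointLimit.lr_add_bt_eq_one hu hg hw L hLc hL0 hL2
  have hfe := add_one_sub hu hf hηw
  linarith

/-! ### The kernel facts -/

/-- **A sequential crossing kernel is STRICTLY increasing on `(0,1)`.**
[cite: BollobasRiordan2006, Ch. 7 §7.1 p. 184] -/
theorem strictMonoOn (hu : Tendsto u atTop (𝓝[>] (0 : ℝ)))
    (hf : ∀ (R : ConformalRectangle) (φ : ConformalEquiv UpperHalfPlane.upperHalfPlaneSet R.carrier)
      (x : Fin 4 → ℝ), R.IsUniformizing φ x →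
      Tendsto (fun n => bondDomainCrossingProb R (u n)) atTop (𝓝 (f (crossRatio x)))) :
    StrictMonoOn f (Ioo (0:ℝ) 1) := by
  obtain ⟨g, hg, -⟩ := exists_jointLimit hf
  obtain ⟨η, hanti, himg, hη⟩ := rectangle_crossRatio_eq_of_aspectRatio_holds
  intro η₁ hη₁ η₂ hη₂ hlt
  obtain ⟨w₁, hw₁, rfl⟩ := (himg.symm ▸ hη₁ : η₁ ∈ η '' Ioi 0)
  obtain ⟨w₂, hw₂, rfl⟩ := (himg.symm ▸ hη₂ : η₂ ∈ η '' Ioi 0)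
  -- `η w₁ < η w₂` forces `w₂ < w₁`
  have hw21 : w₂ < w₁ := by
    by_contra h
    exact absurd hlt (not_lt.2 (hanti.antitoneOn hw₁ hw₂ (not_lt.1 h)))
  obtain ⟨L₁, hc₁, h0₁, h2₁⟩ := JointLimit.exists_lrBox w₁ hw₁
  obtain ⟨L₂, hc₂, h0₂, h2₂⟩ := JointLimit.exists_lrBox w₂ hw₂
  rw [← lr_eq hu hf hg hη hw₁ hη₁ L₁ hc₁ h0₁ h2₁, ← lr_eq hu hf hg hη hw₂ hη₂ L₂ hc₂ h0₂ h2₂]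
  exact JointLimit.lr_strictAnti hu hg hw₂ hw21 L₂ hc₂ h0₂ h2₂ L₁ hc₁ h0₁ h2₁

/-- **A sequential crossing kernel is continuous on `(0,1)`.** [cite: SchrammSmirnov2011, §5] -/
theorem continuousOn (hu : Tendsto u atTop (𝓝[>] (0 : ℝ)))
    (hf : ∀ (R : ConformalRectangle) (φ : ConformalEquiv UpperHalfPlane.upperHalfPlaneSet R.carrier)
      (x : Fin 4 → ℝ), R.IsUniformizing φ x →
      Tendsto (fun n => bondDomainCrossingProb R (u n)) atTop (𝓝 (f (crossRatio x)))) :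
    ContinuousOn f (Ioo (0:ℝ) 1) := by
  obtain ⟨g, hg, -⟩ := exists_jointLimit hf
  obtain ⟨η, hanti, himg, hη⟩ := rectangle_crossRatio_eq_of_aspectRatio_holds
  have hmono := (strictMonoOn hu hf).monotoneOn
  have hηmem : ∀ w : ℝ, 0 < w → η w ∈ Ioo (0:ℝ) 1 := fun w hw => himg ▸ mem_image_of_mem η hw
  intro η₀ hη₀
  obtain ⟨w₀, hw₀, rfl⟩ := (himg.symm ▸ hη₀ : η₀ ∈ η '' Ioi 0)
  obtain ⟨L₀, hc₀, h0₀, h2₀⟩ := JointLimit.exists_lrBox w₀ hw₀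
  refine ContinuousAt.continuousWithinAt ?_
  rw [Metric.continuousAt_iff]
  intro ε hε
  obtain ⟨ρ, hρ, hcont⟩ := JointLimit.lr_continuous hu hg hw₀ L₀ hc₀ h0₀ h2₀ (half_pos hε)
  -- two nearby widths on either side of `w₀`
  set ρ' : ℝ := min ρ (w₀ / 2) with hρ'
  have hρ'0 : 0 < ρ' := lt_min hρ (half_pos hw₀)
  have hρ'ρ : ρ' ≤ ρ := min_le_left _ _
  have hρ'w : ρ' ≤ w₀ / 2 := min_le_right _ _
  set wp : ℝ := w₀ - ρ' with hwp   -- narrower box: larger modulus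
  set wm : ℝ := w₀ + ρ' with hwm   -- wider box: smaller modulus
  have hwp0 : 0 < wp := by rw [hwp]; linarith
  have hwm0 : 0 < wm := by rw [hwm]; linarith
  obtain ⟨Lp, hcp, h0p, h2p⟩ := JointLimit.exists_lrBox wp hwp0
  obtain ⟨Lm, hcm, h0m, h2m⟩ := JointLimit.exists_lrBox wm hwm0
  have hfp : f (η wp) = g Lp := (lr_eq hu hf hg hη hwp0 (hηmem wp hwp0) Lp hcp h0p h2p).symm
  have hfm : f (η wm) = g Lm := (lr_eq hu hf hg hη hwm0 (hηmem wm hwm0) Lm hcm h0m h2m).symm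
  have hf0 : f (η w₀) = g L₀ := (lr_eq hu hf hg hη hw₀ (hηmem w₀ hw₀) L₀ hc₀ h0₀ h2₀).symm
  have hdp : |wp - w₀| ≤ ρ := by
    rw [hwp, show w₀ - ρ' - w₀ = -ρ' by ring, abs_neg, abs_of_pos hρ'0]; exact hρ'ρ
  have hdm : |wm - w₀| ≤ ρ := by
    rw [hwm, show w₀ + ρ' - w₀ = ρ' by ring, abs_of_pos hρ'0]; exact hρ'ρ
  have hgp : |g Lp - g L₀| ≤ ε / 2 := hcont wp hwp0 hdp Lp hcp h0p h2p
  have hgm : |g Lm - g L₀| ≤ ε / 2 := hcont wm hwm0 hdm Lm hcm h0m h2m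
  -- the moduli `η wm < η w₀ < η wp`
  have hlt₁ : η wm < η w₀ := hanti hw₀ hwm0 (by rw [hwm]; linarith)
  have hlt₂ : η w₀ < η wp := hanti hwp0 hw₀ (by rw [hwp]; linarith)
  refine ⟨min (η w₀ - η wm) (η wp - η w₀), lt_min (by linarith) (by linarith), fun t ht => ?_⟩
  rw [Real.dist_eq] at ht ⊢
  have ht1 : η wm < t := by
    have := (abs_lt.1 (ht.trans_le (min_le_left _ _))).1; linarith
  have ht2 : t < η wp := by
    have := (abs_lt.1 (ht.trans_le (min_le_right _ _))).2; linarith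
  have htI : t ∈ Ioo (0:ℝ) 1 := ⟨(hηmem wm hwm0).1.trans ht1, ht2.trans (hηmem wp hwp0).2⟩
  have hle₁ : f (η wm) ≤ f t := hmono (hηmem wm hwm0) htI ht1.le
  have hle₂ : f t ≤ f (η wp) := hmono htI (hηmem wp hwp0) ht2.le
  rw [hfp] at hle₂; rw [hfm] at hle₁; rw [hf0]
  rw [abs_le] at hgp hgm
  rw [abs_lt]
  constructor <;> linarith [hgp.1, hgp.2, hgm.1, hgm.2]

/-- **`f(0⁺) = 0` for every sequential crossing kernel** (long boxes are rarely crossed the long way).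
[cite: BollobasRiordan2006, Ch. 3, proof of eq. (3)] -/
theorem tendsto_zero (hu : Tendsto u atTop (𝓝[>] (0 : ℝ)))
    (hf : ∀ (R : ConformalRectangle) (φ : ConformalEquiv UpperHalfPlane.upperHalfPlaneSet R.carrier)
      (x : Fin 4 → ℝ), R.IsUniformizing φ x →
      Tendsto (fun n => bondDomainCrossingProb R (u n)) atTop (𝓝 (f (crossRatio x)))) :
    Tendsto f (𝓝[>] (0:ℝ)) (𝓝 0) := by
  obtain ⟨g, hg, -⟩ := exists_jointLimit hf
  obtain ⟨η, hanti, himg, hη⟩ := rectangle_crossRatio_eq_of_aspectRatio_holds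
  have hηmem : ∀ w : ℝ, 0 < w → η w ∈ Ioo (0:ℝ) 1 := fun w hw => himg ▸ mem_image_of_mem η hw
  rw [Metric.tendsto_nhdsWithin_nhds]
  intro ε hε
  obtain ⟨W, hW, hsmall⟩ := JointLimit.lr_eventually_le hu hg (half_pos hε)
  refine ⟨η W, (hηmem W hW).1, fun t ht hdist => ?_⟩
  rw [Real.dist_eq, sub_zero] at hdist ⊢
  have ht0 : 0 < t := ht
  have ht1 : t < η W := by have := (abs_lt.1 hdist).2; linarith
  have htI : t ∈ Ioo (0:ℝ) 1 := ⟨ht0, ht1.trans (hηmem W hW).2⟩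
  obtain ⟨w, hw, rfl⟩ := (himg.symm ▸ htI : t ∈ η '' Ioi 0)
  -- `η w < η W` forces `W < w`
  have hWw : W ≤ w := by
    by_contra h
    have := hanti hw hW (not_le.1 h)
    linarith
  obtain ⟨L, hc, h0, h2⟩ := JointLimit.exists_lrBox w hw
  have hval := lr_eq hu hf hg hη hw (hηmem w hw) L hc h0 h2
  have h1 := hsmall w hWw L hc h0 h2
  have h2' := (jointLimit_mem_Ioo hu hg L).1
  rw [← hval, abs_of_pos h2']
  linarith

/-- **`f(1⁻) = 1` for every sequential crossing kernel** (`f η = 1 - f (1 - η)` and `f(0⁺) = 0`).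
[cite: BollobasRiordan2006, Ch. 3, proof of eq. (3)] -/
theorem tendsto_one (hu : Tendsto u atTop (𝓝[>] (0 : ℝ)))
    (hf : ∀ (R : ConformalRectangle) (φ : ConformalEquiv UpperHalfPlane.upperHalfPlaneSet R.carrier)
      (x : Fin 4 → ℝ), R.IsUniformizing φ x →
      Tendsto (fun n => bondDomainCrossingProb R (u n)) atTop (𝓝 (f (crossRatio x)))) :
    Tendsto f (𝓝[<] (1:ℝ)) (𝓝 1) := by
  have h0 := tendsto_zero hu hf
  rw [Metric.tendsto_nhdsWithin_nhds] at h0 ⊢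
  intro ε hε
  obtain ⟨δ, hδ, hδε⟩ := h0 ε hε
  refine ⟨min δ 1, lt_min hδ one_pos, fun t ht hdist => ?_⟩
  rw [Real.dist_eq] at hdist ⊢
  have ht1 : t < 1 := ht
  have ht0 : 0 < t := by
    have := (abs_lt.1 (hdist.trans_le (min_le_right _ _))).1; linarith
  have hfe := add_one_sub hu hf (η := t) ⟨ht0, ht1⟩
  have hs : (1 - t) ∈ Ioi (0:ℝ) := by show 0 < 1 - t; linarith
  have hsd : dist (1 - t) 0 < δ := by
    rw [Real.dist_eq, sub_zero, abs_of_pos (by linarith : 0 < 1 - t)]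
    have := (abs_lt.1 (hdist.trans_le (min_le_left _ _))).1
    linarith
  have key := hδε hs hsd
  rw [Real.dist_eq, sub_zero] at key
  rw [show f t - 1 = -(f (1 - t)) by linarith, abs_neg]
  exact key

end Kernel

/-- **Sub-goal `seqKernelFacts` (line `registered`, lead c5; kernel facts, part 3) — the KERNEL FACTS
along sequences of meshes**: if `u n → 0⁺` and `bondDomainCrossingProb R (u n) → f (crossRatio x)` for
every conformal rectangle `R` and every uniformizing datum `(φ, x)` (the hypothesis of items 8271 / 4680
/ 8850 and of S3 given S2), then `f` is continuous on `(0,1)`, `f(0⁺) = 0` and `f(1⁻) = 1` — the exact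
sequential twin of the landed full-filter `stub_kernelFacts` of crux `CardyRigidity` (stmt-0746).
[cite: BollobasRiordan2006, Ch. 7 §7.1 p. 184] -/
theorem seqKernelFacts : ∀ u : ℕ → ℝ, Filter.Tendsto u Filter.atTop (nhdsWithin (0 : ℝ) (Set.Ioi 0)) → ∀ f : ℝ → ℝ, (∀ (R : Literature.Probability.RandomPlanarGeometry.ConformalRectangle) (φ : Literature.Probability.RandomPlanarGeometry.ConformalEquiv UpperHalfPlane.upperHalfPlaneSet R.carrier) (x : Fin 4 → ℝ), R.IsUniformizing φ x → Filter.Tendsto (fun n => Literature.Probability.Percolation.bondDomainCrossingProb R (u n)) Filter.atTop (nhds (f (Literature.Probability.RandomPlanarGeometry.crossRatio x)))) → ContinuousOn f (Set.Ioo (0 : ℝ) 1) ∧ Filter.Tendsto f (nhdsWithin (0 : ℝ) (Set.Ioi 0)) (nhds 0) ∧ Filter.Tendsto f (nhdsWithin (1 : ℝ) (Set.Iio 1)) (nhds 1) :=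
  fun _ hu _ hf => ⟨Kernel.continuousOn hu hf, Kernel.tendsto_zero hu hf, Kernel.tendsto_one hu hf⟩

/-- **Sub-goal `seqKernel_strictMonoOn` (line `registered`, lead c5; kernel facts, part 3) — every
sequential crossing kernel of bond-`ℤ²` percolation is STRICTLY increasing on `(0,1)`.**
[cite: BollobasRiordan2006, Ch. 7 §7.1 p. 184] -/
theorem seqKernel_strictMonoOn : ∀ u : ℕ → ℝ, Filter.Tendsto u Filter.atTop (nhdsWithin (0 : ℝ) (Set.Ioi 0)) → ∀ f : ℝ → ℝ, (∀ (R : Literature.Probability.RandomPlanarGeometry.ConformalRectangle) (φ : Literature.Probability.RandomPlanarGeometry.ConformalEquiv UpperHalfPlane.upperHalfPlaneSet R.carrier) (x : Fin 4 → ℝ), R.IsUniformizing φ x → Filter.Tendsto (fun n => Literature.Probability.Percolation.bondDomainCrossingProb R (u n)) Filter.atTop (nhds (f (Literature.Probability.RandomPlanarGeometry.crossRatio x)))) → StrictMonoOn f (Set.Ioo (0 : ℝ) 1) :=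
  fun _ hu _ hf => Kernel.strictMonoOn hu hf

end Summit.CriticalPhenomena.CardyFormulaZ2.Cruxes.SubseqCardy.Birth

end
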